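import Summits.HubbardSuperconductivity.HubbardSuperconductivity.Theorems.KacWindowPenaltyWindowGapNormalForms

/-!
# Route `KacWindowPenalty` — crux `WindowGap` (stmt-HubbardSuperconductivity-1088):
# concavity of the penalised sector energy and "without loss of generality `λ` is small"

`g(λ) := minEnergyOn (H + λA) K` is an infimum of affine functions of `λ`, hence concave. Two
finite-dimensional consequences, and their reading on the crux `WindowGap`
(`λ(Cε + a)L² ≤ g_L(λ) − g_L(0)` for the Kac-window pair penalty `A = W_ε` on the Hubbard torus):

* `minEnergyOn_convexComb_le` — `(1 − t)·minEnergyOn A K + t·minEnergyOn B K ≤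
  minEnergyOn ((1 − t)A + tB) K` for `t ∈ [0, 1]` (concavity of the sector energy in the
  operator; no hermiticity, no invariance of `K`, and no non-emptiness hypothesis — for `K`
  without unit vectors all three are the junk value `0`).
* `mul_chord_le_chord_of_le` — the chord from `0` is non-increasing: for `0 < λ' ≤ λ`,
  `(λ'/λ)·(g(λ) − g(0)) ≤ g(λ') − g(0)`.
* `windowGapIneq_mono_lam` — hence the crux's inequality at penalty strength `λ` implies the same
  inequality (same `C, ε, a, L`) at every `λ' ∈ (0, λ]`, and
* `windowGap_small_lam` — `WindowGap` implies, for every `λ₀ > 0`, `WindowGap` with the extra clause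
  `λ ≤ λ₀`: a refutation may assume the penalty arbitrarily weak, a proof may not profit from a
  strong one (the gap saturates: `g_L(λ) − g_L(0) ≤ 32λL²` and `≤ ‖H_L‖`-type bounds).

Supports for the crux (`--supports stmt-HubbardSuperconductivity-1088`); no physics, no new
definitions. H. Tasaki, *Physics and Mathematics of Quantum Many-Body Systems* (2020) §2.1
(variational principle); the concavity of `λ ↦ inf spec (H + λA)` is folklore (e.g. B. Simon,
*The Statistical Mechanics of Lattice Gases* I (1993) §I.2, for the free energy).
-/

-- the mandated namespace `Summit.<Summit>.<Problem>.Theorems` repeats `HubbardSuperconductivity`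
-- (single-problem summit, D-0017), which the `dupNamespace` linter flags on every declaration
set_option linter.dupNamespace false

namespace Summit.HubbardSuperconductivity.HubbardSuperconductivity.Theorems

open Matrix Literature.MathematicalPhysics.QuantumLattice
open Summit.HubbardSuperconductivity.HubbardSuperconductivity.Theses.KacWindowPenalty (WindowGap)

section Abstract

variable {n : Type*} [Fintype n]

/-- **Concavity of the sector energy in the operator.** For matrices `A, B`, a sector `K` and
`t ∈ [0, 1]`: `(1 − t)·minEnergyOn A K + t·minEnergyOn B K ≤ minEnergyOn ((1 − t)A + tB) K`.
Every unit `ψ ∈ K` has `Re ⟨ψ, ((1−t)A + tB)ψ⟩ = (1−t) Re ⟨ψ, Aψ⟩ + t Re ⟨ψ, Bψ⟩`, bounded below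
termwise by the two sector energies (variational principle). If `K` has no unit vector all three
numbers are `sInf ∅ = 0`. Tasaki (2020) §2.1. [folklore] -/
theorem minEnergyOn_convexComb_le (A B : Matrix n n ℂ) (K : Submodule ℂ (n → ℂ)) {t : ℝ}
    (ht0 : 0 ≤ t) (ht1 : t ≤ 1) :
    (1 - t) * A.minEnergyOn K + t * B.minEnergyOn K ≤
      (((1 - t : ℝ) : ℂ) • A + (t : ℂ) • B).minEnergyOn K := by
  by_cases hK : ∃ ψ ∈ K, star ψ ⬝ᵥ ψ = 1
  · obtain ⟨ψ₀, hψ₀K, hψ₀⟩ := hK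
    refine le_csInf ⟨_, ψ₀, hψ₀K, hψ₀, rfl⟩ ?_
    rintro E ⟨ψ, hψK, hψ, rfl⟩
    rw [add_mulVec, dotProduct_add, Complex.add_re, smul_mulVec, dotProduct_smul, smul_eq_mul,
      Complex.re_ofReal_mul, smul_mulVec, dotProduct_smul, smul_eq_mul, Complex.re_ofReal_mul]
    have hA := minEnergyOn_le_re_rayleigh A K hψK hψ
    have hB := minEnergyOn_le_re_rayleigh B K hψK hψ
    have h1t : 0 ≤ 1 - t := by linarith
    nlinarith [mul_le_mul_of_nonneg_left hA h1t, mul_le_mul_of_nonneg_left hB ht0]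
  · -- no unit vector in `K`: every `minEnergyOn · K` is `sInf ∅ = 0`
    have hempty : ∀ M : Matrix n n ℂ,
        {E : ℝ | ∃ ψ ∈ K, star ψ ⬝ᵥ ψ = 1 ∧ E = (star ψ ⬝ᵥ M *ᵥ ψ).re} = ∅ := by
      intro M
      refine Set.eq_empty_iff_forall_notMem.2 ?_
      rintro E ⟨ψ, hψK, hψ, -⟩
      exact hK ⟨ψ, hψK, hψ⟩
    have h0 : ∀ M : Matrix n n ℂ, M.minEnergyOn K = 0 := fun M => by
      rw [Matrix.minEnergyOn, hempty M, Real.sInf_empty]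
    rw [h0, h0, h0]
    linarith

/-- **The chord from `0` of the penalised sector energy is non-increasing in the coupling.**
For `0 < λ' ≤ λ` and `g(μ) := minEnergyOn (H + μA) K`:
`(λ'/λ)·(g(λ) − g(0)) ≤ g(λ') − g(0)` (concavity, `minEnergyOn_convexComb_le` with `t = λ'/λ`,
since `(1 − t)H + t(H + λA) = H + λ'A`). Tasaki (2020) §2.1. [folklore] -/
theorem mul_chord_le_chord_of_le (H A : Matrix n n ℂ) (K : Submodule ℂ (n → ℂ)) {lam lam' : ℝ}
    (hlam' : 0 < lam') (hle : lam' ≤ lam) :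
    lam' / lam * ((H + (lam : ℂ) • A).minEnergyOn K - H.minEnergyOn K) ≤
      (H + (lam' : ℂ) • A).minEnergyOn K - H.minEnergyOn K := by
  have hlam : 0 < lam := hlam'.trans_le hle
  have ht0 : 0 ≤ lam' / lam := (div_pos hlam' hlam).le
  have ht1 : lam' / lam ≤ 1 := (div_le_one hlam).2 hle
  have key := minEnergyOn_convexComb_le H (H + (lam : ℂ) • A) K ht0 ht1
  have hmat : ((1 - lam' / lam : ℝ) : ℂ) • H + ((lam' / lam : ℝ) : ℂ) • (H + (lam : ℂ) • A) =
      H + (lam' : ℂ) • A := by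
    rw [smul_add, smul_smul, ← add_assoc, ← add_smul, ← Complex.ofReal_add, sub_add_cancel,
      Complex.ofReal_one, one_smul, ← Complex.ofReal_mul, div_mul_cancel₀ lam' hlam.ne']
  rw [hmat] at key
  have hsplit : lam' / lam * ((H + (lam : ℂ) • A).minEnergyOn K - H.minEnergyOn K) =
      (1 - lam' / lam) * H.minEnergyOn K + lam' / lam * (H + (lam : ℂ) • A).minEnergyOn K -
        H.minEnergyOn K := by ring
  rw [hsplit]
  linarith

/-- **The crux's inequality descends to weaker penalties.** If `λ b ≤ g(λ) − g(0)`
(`g(μ) = minEnergyOn (H + μA) K`) and `0 < λ' ≤ λ`, then `λ' b ≤ g(λ') − g(0)`. In the crux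
`b = (Cε + a)L²`, `A = W_ε`: the extensive window excess at strength `λ` persists, with the SAME
`C, ε, a`, at every weaker strength. [folklore] -/
theorem windowGapIneq_mono_lam (H A : Matrix n n ℂ) (K : Submodule ℂ (n → ℂ)) {lam lam' b : ℝ}
    (hlam' : 0 < lam') (hle : lam' ≤ lam)
    (h : lam * b ≤ (H + (lam : ℂ) • A).minEnergyOn K - H.minEnergyOn K) :
    lam' * b ≤ (H + (lam' : ℂ) • A).minEnergyOn K - H.minEnergyOn K := by
  have hlam : 0 < lam := hlam'.trans_le hle
  have key := mul_chord_le_chord_of_le H A K hlam' hle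
  have h1 : lam' / lam * (lam * b) ≤
      lam' / lam * ((H + (lam : ℂ) • A).minEnergyOn K - H.minEnergyOn K) :=
    mul_le_mul_of_nonneg_left h (div_pos hlam' hlam).le
  have h2 : lam' / lam * (lam * b) = lam' * b := by
    rw [← mul_assoc, div_mul_cancel₀ lam' hlam.ne']
  linarith

end Abstract

/-- **`WindowGap` without loss of generality at weak penalty** (stmt-HubbardSuperconductivity-1088):
if `WindowGap` holds then for every `λ₀ > 0` it holds with a witness whose penalty strength obeys
`λ ≤ λ₀` (all other data — `U, δ, ε, a, L₀` — unchanged; `λ ↦ min λ λ₀`,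
`windowGapIneq_mono_lam`). So a refutation may restrict to arbitrarily weak Kac-window
repulsions, and strong penalties carry no extra information. [folklore] -/
theorem windowGap_small_lam (h : WindowGap) (lam₀ : ℝ) (hlam₀ : 0 < lam₀) :
    ∃ U : ℝ, 0 < U ∧ ∃ δ ∈ Set.Ioo (0:ℝ) (1 / 2), ∀ C : ℝ, 0 ≤ C → ∀ ε₀ : ℝ, 0 < ε₀ →
      ∃ ε ∈ Set.Ioc (0:ℝ) ε₀, ∃ lam a : ℝ, 0 < lam ∧ lam ≤ lam₀ ∧ 0 < a ∧ ∃ L₀ : ℕ,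
        ∀ (L : ℕ) [NeZero L], L₀ ≤ L → Even L →
          lam * (C * ε + a) * (L : ℝ) ^ 2 ≤
            (hubbardTorus 2 L 1 U + (lam : ℂ) • (∑ m : Fin 2 → ZMod L,
                if (2 * Real.pi / (L : ℝ)) ^ 2 * (∑ i : Fin 2, (((m i).valMinAbs : ℤ) : ℝ) ^ 2) ≤ ε ^ 2
                then ((L : ℂ) ^ 2)⁻¹ • (Matrix.conjTranspose (pairFieldAt dWaveFormFactor L m) *
                  pairFieldAt dWaveFormFactor L m)
                else 0)).minEnergyOn (szSector (2 * ⌊(1 - δ) * (L : ℝ) ^ 2 / 2⌋₊) 0) -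
              (hubbardTorus 2 L 1 U).minEnergyOn (szSector (2 * ⌊(1 - δ) * (L : ℝ) ^ 2 / 2⌋₊) 0) := by
  obtain ⟨U, hU, δ, hδ, hG⟩ := h
  refine ⟨U, hU, δ, hδ, fun C hC ε₀ hε₀ => ?_⟩
  obtain ⟨ε, hε, lam, a, hlam, ha, L₀, hL⟩ := hG C hC ε₀ hε₀
  refine ⟨ε, hε, min lam lam₀, a, lt_min hlam hlam₀, min_le_right _ _, ha, L₀, ?_⟩
  intro L _ hL₀ hE
  have key := windowGapIneq_mono_lam (hubbardTorus 2 L 1 U) _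
    (szSector (2 * ⌊(1 - δ) * (L : ℝ) ^ 2 / 2⌋₊) 0) (lt_min hlam hlam₀) (min_le_left lam lam₀)
    (b := (C * ε + a) * (L : ℝ) ^ 2) (by rw [← mul_assoc]; exact hL L hL₀ hE)
  rw [← mul_assoc] at key
  exact key

end Summit.HubbardSuperconductivity.HubbardSuperconductivity.Theorems
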